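import Literature.ModelTheory.Zilber.EACDensityLineTwist
import HarnessLib

/-!
# Real-slope line surfaces I: elimination along convergent fibres, Kronecker, minimum modulus

HONEST FRAMING.  Part of a three-file proof of modest rungs of the case ladder of ZILBER'S
EXPONENTIAL-ALGEBRAIC CLOSEDNESS conjecture (EAC): the Mantova–Masser "unprojected density" question
for the line surfaces `{x₁ = a x₀ + b, y₀ = q(y₁)}` of REAL irrational slope (main theorems in
`ZilberEacDensityRealSlope`).  It is NOT Schanuel's conjecture, does not use it, and EAC does not
imply Schanuel's conjecture; `EC(3,2)` and the density question in general remain OPEN.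

Contents (all proved from Mathlib and the proved infrastructure of
`Literature.ModelTheory.Zilber.EACDensity*`; the method is the classical Kronecker–Rouché analysis
of zeros of exponential polynomials with real frequencies — C. J. Moreno, Compositio Math. 26
(1973); C. E. Avellar – J. K. Hale, J. Math. Anal. Appl. 73 (1980), Thm 3.1 — re-proved in the form
needed):

* Part A — elimination along CONVERGENT fibres: a polynomial `G(w, z)` vanishing at points with
  `|z_k| → ∞`, `w_k → w₀` for infinitely many `w₀` is `0`; density criterion
  `unprojectedDense_graphPolySurface_of_limits` for the graph surfaces `S_{p,q}`.
* Part B — Kronecker: for `a ∉ ℚ` the rotations `e^{2πi n a}`, `|n| ≥ N`, approximate every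
  unimodular `u` (`exists_urot_near`).
* Part C — minimum modulus (Rouché replaced by the maximum modulus principle for `1/f`): `|f| ≥ m`
  on a circle and `|f(c)| < m` force a zero inside (`exists_zero_of_norm_lt_of_sphere`); a circle
  of positive minimum modulus about any point of an entire `Φ ≢ 0` (`exists_sphere_norm_le`).
-/

noncomputable section

open Filter Topology Metric Set Complex Polynomial Bornology
open Literature.NumberTheory.Transcendental Literature.ModelTheory.Zilber
open Literature.ModelTheory.ExponentialFields

set_option linter.dupNamespace false

namespace Summit.Schanuel.Schanuel.Theorems

/-! ## Part A. Elimination along convergent fibres with infinitely many limits -/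

section Elimination

/-- If `G ∈ ℂ[w][z]` vanishes at `(w_k, z_k)` with `|z_k| → ∞` and `w_k → w₀`, then the leading
`z`-coefficient of `G` vanishes at `w₀`. (new) -/
theorem leadingCoeff_eval_eq_zero_of_tendsto (G : Polynomial (Polynomial ℂ)) (z w : ℕ → ℂ)
    (hz : Tendsto (fun k => ‖z k‖) atTop atTop) {w₀ : ℂ} (hw : Tendsto w atTop (𝓝 w₀))
    (hG : ∀ k, G.eval₂ (Polynomial.evalRingHom (w k)) (z k) = 0) :
    G.leadingCoeff.eval w₀ = 0 := by
  obtain ⟨B, hB⟩ : ∃ B, ∀ k, ‖w k‖ ≤ B := by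
    obtain ⟨B, hB⟩ := isBounded_iff_forall_norm_le.1 (Metric.isBounded_range_of_tendsto w hw)
    exact ⟨B, fun k => hB _ (Set.mem_range_self k)⟩
  have h1 := tendsto_norm_leadingCoeff_eval G z w hz hB hG
  have h2 : Tendsto (fun k => ‖G.leadingCoeff.eval (w k)‖) atTop (𝓝 ‖G.leadingCoeff.eval w₀‖) :=
    ((G.leadingCoeff.continuous.tendsto w₀).comp hw).norm
  have h3 := tendsto_nhds_unique h2 h1
  rwa [norm_eq_zero] at h3

/-- **Elimination lemma, convergent fibres.** If for every `w₀` in an INFINITE set `A` the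
polynomial `G ∈ ℂ[w][z]` vanishes along a sequence `(w_k, z_k)` with `|z_k| → ∞` and `w_k → w₀`,
then `G = 0` (its leading `z`-coefficient would have infinitely many roots). (new) -/
theorem eq_zero_of_infinite_limits (G : Polynomial (Polynomial ℂ)) {A : Set ℂ} (hA : A.Infinite)
    (h : ∀ w₀ ∈ A, ∃ z w : ℕ → ℂ, Tendsto (fun k => ‖z k‖) atTop atTop ∧
      Tendsto w atTop (𝓝 w₀) ∧ ∀ k, G.eval₂ (Polynomial.evalRingHom (w k)) (z k) = 0) :
    G = 0 := by
  by_contra hG0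
  have hlc : G.leadingCoeff ≠ 0 := Polynomial.leadingCoeff_ne_zero.mpr hG0
  refine hA ((G.leadingCoeff.roots.toFinset.finite_toSet).subset fun w₀ hw₀ => ?_)
  obtain ⟨z, w, hz, hw, hG⟩ := h w₀ hw₀
  have h0 := leadingCoeff_eval_eq_zero_of_tendsto G z w hz hw hG
  simp only [Finset.mem_coe, Multiset.mem_toFinset]
  exact (Polynomial.mem_roots hlc).mpr h0

/-- **Density criterion, convergent fibres.** If `S_{p,q} = {x₁ = p(x₀), y₀ = q(y₁)}` carries, for
every `w₀` in an infinite set `A`, exponential points `(z_k, p(z_k), q(w_k), w_k)` with `|z_k| → ∞`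
and `w_k → w₀`, then `I(S_{p,q} ∩ Γ_exp) = I(S_{p,q})`. (new) -/
theorem unprojectedDense_graphPolySurface_of_limits (p q : Polynomial ℂ) {A : Set ℂ}
    (hA : A.Infinite)
    (h : ∀ w₀ ∈ A, ∃ z w : ℕ → ℂ, Tendsto (fun k => ‖z k‖) atTop atTop ∧
      Tendsto w atTop (𝓝 w₀) ∧ (∀ k, exp (z k) = q.eval (w k)) ∧ ∀ k, exp (p.eval (z k)) = w k) :
    UnprojectedDense (graphPolySurface p q) := by
  refine le_antisymm ?_ (MvPolynomial.vanishingIdeal_anti_mono Set.inter_subset_left)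
  intro F hF
  have hG0 : gpPullbackT p q F = 0 := by
    refine eq_zero_of_infinite_limits (gpPullbackT p q F) hA fun w₀ hw₀ => ?_
    obtain ⟨z, w, hz, hw, hexp₁, hexp₂⟩ := h w₀ hw₀
    refine ⟨z, w, hz, hw, fun k => ?_⟩
    rw [← mmEval_eq_eval₂, mmEval_gpPullbackT]
    exact eval_eq_zero_of_mem_vanishingIdeal hF
      ⟨gpParam_mem p q _ _, gpParam_mem_expGraph p q (hexp₁ k) (hexp₂ k)⟩
  refine mem_vanishingIdeal_of_eval fun s hs => ?_
  have h := mmEval_gpPullbackT p q F (s (Sum.inl 0)) (s (Sum.inr 1))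
  rw [hG0, map_zero, ← eq_gpParam_of_mem p q hs] at h
  exact h.symm

end Elimination

/-! ## Part B. Kronecker: the rotation `n ↦ e^{2πi n a}` for irrational real `a` -/

section Kronecker

/-- The rotation `urot x = e^{2πi x}`. (new) -/
def urot (x : ℝ) : ℂ := exp ((x : ℂ) * (2 * Real.pi * I))

/-- `|urot x| = 1`. -/
theorem norm_urot (x : ℝ) : ‖urot x‖ = 1 := by
  rw [urot, Complex.norm_exp]
  simp

/-- `urot (x + m) = urot x` for `m ∈ ℤ`. -/
theorem urot_add_int (x : ℝ) (m : ℤ) : urot (x + m) = urot x := by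
  rw [urot, urot, Complex.ofReal_add, add_mul, Complex.exp_add, Complex.ofReal_intCast,
    Complex.exp_int_mul_two_pi_mul_I, mul_one]

/-- `urot` is continuous. -/
theorem continuous_urot : Continuous urot :=
  Complex.continuous_exp.comp (Complex.continuous_ofReal.mul continuous_const)

/-- Every unimodular complex number is a `urot θ`. -/
theorem exists_urot_eq_of_norm_eq_one {u : ℂ} (hu : ‖u‖ = 1) : ∃ θ : ℝ, urot θ = u := by
  obtain ⟨t, ht⟩ := (Complex.norm_eq_one_iff u).1 hu
  refine ⟨t / (2 * Real.pi), ?_⟩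
  rw [urot, ← ht]
  congr 1
  push_cast
  field_simp

/-- `ℤ a + ℤ` is dense in `ℝ` for irrational `a`: it meets every open interval. -/
theorem exists_int_pair_mem_Ioo {a : ℝ} (ha : Irrational a) {lo hi : ℝ} (h : lo < hi) :
    ∃ n m : ℤ, lo < n * a + m ∧ n * a + m < hi := by
  have hd : Dense (AddSubgroup.closure {a, (1 : ℝ)} : Set ℝ) :=
    dense_addSubgroupClosure_pair_iff.2 (by rwa [div_one])
  obtain ⟨x, hx, hlo, hhi⟩ := hd.exists_mem_open isOpen_Ioo (nonempty_Ioo.2 h)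
  obtain ⟨n, m, rfl⟩ := AddSubgroup.mem_closure_pair.1 (SetLike.mem_coe.1 hx)
  refine ⟨n, m, ?_, ?_⟩
  · simpa [zsmul_eq_mul] using hlo
  · simpa [zsmul_eq_mul] using hhi

/-- **Kronecker with large multiplier**: for irrational `a`, every `θ`, `ε > 0` and `N` there are
integers `n, m` with `|n| ≥ N` and `|n a + m - θ| < ε`. -/
theorem exists_int_near_of_irrational {a : ℝ} (ha : Irrational a) (θ : ℝ) {ε : ℝ} (hε : 0 < ε)
    (N : ℕ) : ∃ n m : ℤ, (N : ℝ) ≤ |(n : ℝ)| ∧ |n * a + m - θ| < ε := by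
  obtain ⟨n', m', hs0, hs1⟩ := exists_int_pair_mem_Ioo ha (lt_min hε one_pos)
  set s : ℝ := n' * a + m' with hs
  have hsε : s < ε := hs1.trans_le (min_le_left _ _)
  have hs1' : s < 1 := hs1.trans_le (min_le_right _ _)
  have hn' : n' ≠ 0 := by
    rintro rfl
    have h0 : (0 : ℝ) < m' := by simpa [hs] using hs0
    have h1 : (m' : ℝ) < 1 := by simpa [hs] using hs1'
    have h0' : (0 : ℤ) < m' := by exact_mod_cast h0
    have h1' : m' < (1 : ℤ) := by exact_mod_cast h1
    omega
  obtain ⟨j, hj⟩ := exists_nat_ge (s * (N + 1) - θ)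
  set T : ℝ := θ + j with hT
  have hTs : s * (N + 1) ≤ T := by linarith
  set k : ℤ := ⌊T / s⌋ with hk
  have hk1 : (k : ℝ) ≤ T / s := Int.floor_le _
  have hk2 : T / s < k + 1 := Int.lt_floor_add_one _
  refine ⟨k * n', k * m' - j, ?_, ?_⟩
  · have hNk : (N : ℝ) ≤ k := by
      have : (N : ℝ) + 1 ≤ T / s := by rw [le_div_iff₀ hs0]; linarith
      linarith
    have hn'1 : (1 : ℝ) ≤ |(n' : ℝ)| := by
      rw [← Int.cast_abs]; exact_mod_cast Int.one_le_abs hn'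
    calc (N : ℝ) ≤ k := hNk
      _ ≤ |(k : ℝ)| := le_abs_self _
      _ = |(k : ℝ)| * 1 := (mul_one _).symm
      _ ≤ |(k : ℝ)| * |(n' : ℝ)| := mul_le_mul_of_nonneg_left hn'1 (abs_nonneg _)
      _ = |((k * n' : ℤ) : ℝ)| := by push_cast; rw [abs_mul]
  · have e : ((k * n' : ℤ) : ℝ) * a + ((k * m' - j : ℤ) : ℝ) - θ = k * s - T := by
      simp only [hs, hT]; push_cast; ring
    rw [e]
    have h1' : (k : ℝ) * s ≤ T := by rwa [le_div_iff₀ hs0] at hk1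
    have h2' : T < ((k : ℝ) + 1) * s := by rwa [div_lt_iff₀ hs0] at hk2
    rw [abs_sub_lt_iff]
    constructor <;> nlinarith

/-- **Kronecker on the circle**: for irrational `a` the rotations `urot (n a)`, `|n| ≥ N`, come
within any `ε` of any unimodular `u`. -/
theorem exists_urot_near {a : ℝ} (ha : Irrational a) {u : ℂ} (hu : ‖u‖ = 1) {ε : ℝ} (hε : 0 < ε)
    (N : ℕ) : ∃ n : ℤ, (N : ℝ) ≤ |(n : ℝ)| ∧ ‖urot (n * a) - u‖ < ε := by
  obtain ⟨θ, rfl⟩ := exists_urot_eq_of_norm_eq_one hu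
  obtain ⟨δ, hδ, hδε⟩ := Metric.continuousAt_iff.1 continuous_urot.continuousAt ε hε
  obtain ⟨n, m, hn, hnm⟩ := exists_int_near_of_irrational ha θ hδ N
  refine ⟨n, hn, ?_⟩
  rw [← urot_add_int (n * a) m, ← dist_eq_norm]
  exact hδε (by rw [Real.dist_eq]; exact_mod_cast hnm)

end Kronecker

/-! ## Part C. Minimum modulus: a holomorphic function small at the centre and large on a circle
has a zero inside -/

section MinModulus

/-- **Minimum-modulus zero lemma** (the Rouché step, via the maximum modulus principle for `1/f`):
if `f` is holomorphic on `ball c R`, `|f| ≥ m` on the sphere of radius `r < R` and `|f c| < m`, then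
`f` has a zero in `ball c r`. -/
theorem exists_zero_of_norm_lt_of_sphere {f : ℂ → ℂ} {c : ℂ} {r R m : ℝ} (hr : 0 < r)
    (hrR : r < R) (hf : DifferentiableOn ℂ f (ball c R)) (hm : ∀ z ∈ sphere c r, m ≤ ‖f z‖)
    (hc : ‖f c‖ < m) : ∃ z ∈ ball c r, f z = 0 := by
  by_contra h
  push Not at h
  have hm0 : 0 < m := (norm_nonneg _).trans_lt hc
  have hne : ∀ z ∈ closedBall c r, f z ≠ 0 := by
    intro z hz
    rcases (mem_closedBall.1 hz).lt_or_eq with hzr | hzr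
    · exact h z (mem_ball.2 hzr)
    · intro h0
      have := hm z (mem_sphere.2 hzr)
      rw [h0, norm_zero] at this
      exact absurd this (not_le.2 hm0)
  have hg : DiffContOnCl ℂ (f⁻¹) (ball c r) := by
    refine DifferentiableOn.diffContOnCl_ball (U := closedBall c r) ?_ Subset.rfl
    exact (hf.mono (closedBall_subset_ball hrR)).inv hne
  have hle : ‖(f⁻¹) c‖ ≤ m⁻¹ := by
    refine Complex.norm_le_of_forall_mem_frontier_norm_le isBounded_ball hg ?_
      (subset_closure (mem_ball_self hr))
    intro z hz
    rw [frontier_ball c hr.ne'] at hz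
    rw [Pi.inv_apply, norm_inv]
    exact inv_anti₀ hm0 (hm z hz)
  rw [Pi.inv_apply, norm_inv] at hle
  have hfc : 0 < ‖f c‖ := norm_pos_iff.2 (hne c (mem_closedBall_self hr.le))
  have hlt : m⁻¹ < ‖f c‖⁻¹ := inv_strictAnti₀ hfc hc
  exact absurd hle (not_le.2 hlt)

/-- **Small circles avoiding the zeros.** If `Φ` is entire and not identically zero, then around any
`x` there are arbitrarily small circles on which `|Φ|` has a positive lower bound (zeros of `Φ` are
isolated). -/
theorem exists_sphere_norm_le {Φ : ℂ → ℂ} (hΦ : Differentiable ℂ Φ) (hne : ∃ z, Φ z ≠ 0) (x : ℂ)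
    {ε : ℝ} (hε : 0 < ε) :
    ∃ r, 0 < r ∧ r ≤ ε ∧ ∃ m, 0 < m ∧ ∀ z ∈ sphere x r, m ≤ ‖Φ z‖ := by
  have han : AnalyticOnNhd ℂ Φ Set.univ := hΦ.differentiableOn.analyticOnNhd isOpen_univ
  rcases (han x (Set.mem_univ x)).eventually_eq_zero_or_eventually_ne_zero with h0 | h1
  · exfalso
    obtain ⟨z, hz⟩ := hne
    have heq := han.eqOn_zero_of_preconnected_of_eventuallyEq_zero isPreconnected_univ
      (Set.mem_univ x) h0
    exact hz (heq (Set.mem_univ z))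
  · obtain ⟨δ, hδ, hδne⟩ : ∃ δ > 0, ∀ z, z ≠ x → dist z x < δ → Φ z ≠ 0 := by
      rw [eventually_nhdsWithin_iff, Metric.eventually_nhds_iff] at h1
      obtain ⟨δ, hδ, h⟩ := h1
      exact ⟨δ, hδ, fun z h0 hz => h hz h0⟩
    set r := min (δ / 2) ε with hr
    have hr0 : 0 < r := lt_min (half_pos hδ) hε
    have hcont : ContinuousOn (fun z => ‖Φ z‖) (sphere x r) := hΦ.continuous.norm.continuousOn
    obtain ⟨z₀, hz₀, hmin⟩ := (isCompact_sphere x r).exists_isMinOn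
      (NormedSpace.sphere_nonempty.2 hr0.le) hcont
    refine ⟨r, hr0, min_le_right _ _, ‖Φ z₀‖, ?_, fun z hz => (isMinOn_iff.1 hmin) z hz⟩
    have hz₀r : dist z₀ x = r := mem_sphere.1 hz₀
    refine norm_pos_iff.2 (hδne z₀ ?_ ?_)
    · intro h
      rw [h, dist_self] at hz₀r
      exact hr0.ne hz₀r
    · rw [hz₀r]
      exact (min_le_left _ _).trans_lt (half_lt_self hδ)

end MinModulus

end Summit.Schanuel.Schanuel.Theorems
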